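import Mathlib
import Summits.Ventures.HodgeRepro.Tier4.Common.AdelicDefs
import Summits.Ventures.HodgeRepro.Tier4.Common.AdelicRTF
import Summits.Ventures.HodgeRepro.Tier4.Line1.CMDefinedContent

/-!
# Tier4/Line1/TrivialCharacters — the R4 witness of the character clauses of `exists_periods_ofCharacters`: the
trivial characters satisfy every displayed clause, so the DEFINED half of the costume's RTF datum is NOT vacuous — and
its whole content sits in WHICH characters (the free identification)

Blind re-derivation cell `pub-hodge-repro`, Tier 4 (README §9–§10), seat t4-L1-p3 (gen 2).  Target tree path
`lean/Summits/Ventures/HodgeRepro/Tier4/Line1/TrivialCharacters.lean`.  Imports `Line1.CMDefinedContent`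
(`exists_periods_ofCharacters`), through it p4's `RTFData.ofCharacters`, p5's `quotient_compact_genuine`.

WHY (the cell's R4 discipline — every displayed hypothesis bundle gets a witness, and every junk instance is a test of
truth, not a witness of content): `exists_periods_ofCharacters W hW hg μ chi chi' hmul hmul' hrat hrat' hcentre hc hu
hc' hu'` asks of the characters seven clauses (multiplicative, trivial on the rational points, N2 on the centre) plus
continuity and unitarity.  The constant characters `χ = χ′ = 1` satisfy all nine (`trivial_characters_clauses`), and
the theorem then yields (`exists_periods_ofCharacters_trivial`) an invariant subspace `τ m` of `L²([U(W)])` on which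
both TRIVIAL toric functionals `∫_{DT} ψ`, `∫_{DT′} ψ` are non-zero — e.g. the constants.  READ THIS RIGHT: the relative
trace formula on the compact quotient is a true theorem for EVERY admissible pair of characters; what singles out the
`τ` of the step (P) is the pair `χ = ν₀ ⊗ ν₁`, `χ′ = ν₂ ⊗ ν₃` of the corner characters through the printed
identification `f^*ω_j = θ(μ_j)` (BMM Cor 65 / Liu Prop 4.13) — the FREE half of `line1_realise`, never claimed here.
Nothing here says anything about the status of the Hodge conjecture for CM abelian varieties, which is NOT proved
(HC_CM is NOT proved by anyone in this repository).
-/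

set_option autoImplicit false

noncomputable section

namespace Summit.Ventures.HodgeRepro.Tier4.Line1

open NumberField Common MeasureTheory

section Witness

variable {k : Type} [Field k] [NumberField k] (W : PlaneData k)

/-- **The trivial characters satisfy the nine displayed clauses** of `exists_periods_ofCharacters`: multiplicative,
trivial on the rational points, equal on the centre (N2), continuous, unitary. -/
theorem trivial_characters_clauses :
    (∀ s t : torusT W, (fun _ : torusT W => (1 : ℂ)) (s * t) =
      (fun _ : torusT W => (1 : ℂ)) s * (fun _ : torusT W => (1 : ℂ)) t) ∧
    (∀ s t : torusT' W, (fun _ : torusT' W => (1 : ℂ)) (s * t) =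
      (fun _ : torusT' W => (1 : ℂ)) s * (fun _ : torusT' W => (1 : ℂ)) t) ∧
    (∀ t : torusT W, (t : GA W) ∈ rationalPoints W → (fun _ : torusT W => (1 : ℂ)) t = 1) ∧
    (∀ t : torusT' W, (t : GA W) ∈ rationalPoints W → (fun _ : torusT' W => (1 : ℂ)) t = 1) ∧
    (∀ (z : GA W) (hz : z ∈ centre W),
      (fun _ : torusT W => (1 : ℂ)) ⟨z, centre_le_torusT W hz⟩ =
        (fun _ : torusT' W => (1 : ℂ)) ⟨z, centre_le_torusT' W hz⟩) ∧
    Continuous (fun _ : torusT W => (1 : ℂ)) ∧ (∀ x : torusT W, ‖(fun _ : torusT W => (1 : ℂ)) x‖ = 1) ∧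
    Continuous (fun _ : torusT' W => (1 : ℂ)) ∧ (∀ x : torusT' W, ‖(fun _ : torusT' W => (1 : ℂ)) x‖ = 1) :=
  ⟨fun _ _ => by simp, fun _ _ => by simp, fun _ _ => rfl, fun _ _ => rfl, fun _ _ => rfl,
    continuous_const, fun _ => by simp, continuous_const, fun _ => by simp⟩

variable [MeasurableSpace (GA W)] [BorelSpace (GA W)]

/-- **The RTF output for the trivial characters** (the non-vacuity witness of `exists_periods_ofCharacters`): for a
definite genuine plane and a Haar measure there are a relatively compact fundamental domain `DG`, an adapted family and
an invariant subspace `τ m` of `L²(DG)`, hit by `f̄₁`, on which both trivial toric functionals are non-zero. -/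
theorem exists_periods_ofCharacters_trivial (hW : IsDefinite W) (hg : IsGenuineRow W) (μ : Measure (GA W))
    [μ.IsHaarMeasure] :
    haveI := ofCharacters_μT_isHaarMeasure W hW hg (fun _ => 1) (fun _ => 1) (trivial_characters_clauses W).1
      (trivial_characters_clauses W).2.1 (trivial_characters_clauses W).2.2.1 (trivial_characters_clauses W).2.2.2.1
      (trivial_characters_clauses W).2.2.2.2.1
    haveI := ofCharacters_μT'_isHaarMeasure W hW hg (fun _ => 1) (fun _ => 1) (trivial_characters_clauses W).1
      (trivial_characters_clauses W).2.1 (trivial_characters_clauses W).2.2.1 (trivial_characters_clauses W).2.2.2.1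
      (trivial_characters_clauses W).2.2.2.2.1
    ∃ (DG : Set (GA W)) (fdG : IsFundamentalDomain (rationalPoints W) DG μ) (compG : IsCompact (closure DG))
      (τ : ℕ → Set (GA W → ℂ)) (φ : ℕ → GA W → ℂ) (n : ℕ → ℕ) (f₁ : GA W → ℂ) (m : ℕ),
      (Setting.ofAdelicData W (RTFData.ofCharacters W hW hg (fun _ => 1) (fun _ => 1)
          (trivial_characters_clauses W).1 (trivial_characters_clauses W).2.1 (trivial_characters_clauses W).2.2.1
          (trivial_characters_clauses W).2.2.2.1 (trivial_characters_clauses W).2.2.2.2.1) μ DG fdG compG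
        (ofCharacters_hT W hW hg (fun _ => 1) (fun _ => 1) (trivial_characters_clauses W).1
          (trivial_characters_clauses W).2.1 (trivial_characters_clauses W).2.2.1 (trivial_characters_clauses W).2.2.2.1
          (trivial_characters_clauses W).2.2.2.2.1)
        (ofCharacters_hT' W hW hg (fun _ => 1) (fun _ => 1) (trivial_characters_clauses W).1
          (trivial_characters_clauses W).2.1 (trivial_characters_clauses W).2.2.1 (trivial_characters_clauses W).2.2.2.1
          (trivial_characters_clauses W).2.2.2.2.1)).IsAdaptedONB τ φ n ∧
      RTF.IsTest f₁ ∧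
      (Setting.ofAdelicData W (RTFData.ofCharacters W hW hg (fun _ => 1) (fun _ => 1)
          (trivial_characters_clauses W).1 (trivial_characters_clauses W).2.1 (trivial_characters_clauses W).2.2.1
          (trivial_characters_clauses W).2.2.2.1 (trivial_characters_clauses W).2.2.2.2.1) μ DG fdG compG
        (ofCharacters_hT W hW hg (fun _ => 1) (fun _ => 1) (trivial_characters_clauses W).1
          (trivial_characters_clauses W).2.1 (trivial_characters_clauses W).2.2.1 (trivial_characters_clauses W).2.2.2.1
          (trivial_characters_clauses W).2.2.2.2.1)
        (ofCharacters_hT' W hW hg (fun _ => 1) (fun _ => 1) (trivial_characters_clauses W).1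
          (trivial_characters_clauses W).2.1 (trivial_characters_clauses W).2.2.1 (trivial_characters_clauses W).2.2.2.1
          (trivial_characters_clauses W).2.2.2.2.1)).PeriodNonzeroT (fun _ => 1) (τ m) ∧
      (Setting.ofAdelicData W (RTFData.ofCharacters W hW hg (fun _ => 1) (fun _ => 1)
          (trivial_characters_clauses W).1 (trivial_characters_clauses W).2.1 (trivial_characters_clauses W).2.2.1
          (trivial_characters_clauses W).2.2.2.1 (trivial_characters_clauses W).2.2.2.2.1) μ DG fdG compG
        (ofCharacters_hT W hW hg (fun _ => 1) (fun _ => 1) (trivial_characters_clauses W).1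
          (trivial_characters_clauses W).2.1 (trivial_characters_clauses W).2.2.1 (trivial_characters_clauses W).2.2.2.1
          (trivial_characters_clauses W).2.2.2.2.1)
        (ofCharacters_hT' W hW hg (fun _ => 1) (fun _ => 1) (trivial_characters_clauses W).1
          (trivial_characters_clauses W).2.1 (trivial_characters_clauses W).2.2.1 (trivial_characters_clauses W).2.2.2.1
          (trivial_characters_clauses W).2.2.2.2.1)).PeriodNonzeroT' (fun _ => 1) (τ m) ∧
      (Setting.ofAdelicData W (RTFData.ofCharacters W hW hg (fun _ => 1) (fun _ => 1)
          (trivial_characters_clauses W).1 (trivial_characters_clauses W).2.1 (trivial_characters_clauses W).2.2.1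
          (trivial_characters_clauses W).2.2.2.1 (trivial_characters_clauses W).2.2.2.2.1) μ DG fdG compG
        (ofCharacters_hT W hW hg (fun _ => 1) (fun _ => 1) (trivial_characters_clauses W).1
          (trivial_characters_clauses W).2.1 (trivial_characters_clauses W).2.2.1 (trivial_characters_clauses W).2.2.2.1
          (trivial_characters_clauses W).2.2.2.2.1)
        (ofCharacters_hT' W hW hg (fun _ => 1) (fun _ => 1) (trivial_characters_clauses W).1
          (trivial_characters_clauses W).2.1 (trivial_characters_clauses W).2.2.1 (trivial_characters_clauses W).2.2.2.1
          (trivial_characters_clauses W).2.2.2.2.1)).Hit (RTF.cj f₁) (τ m) :=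
  exists_periods_ofCharacters W hW hg μ (fun _ => 1) (fun _ => 1) (trivial_characters_clauses W).1
    (trivial_characters_clauses W).2.1 (trivial_characters_clauses W).2.2.1 (trivial_characters_clauses W).2.2.2.1
    (trivial_characters_clauses W).2.2.2.2.1 (trivial_characters_clauses W).2.2.2.2.2.1
    (trivial_characters_clauses W).2.2.2.2.2.2.1 (trivial_characters_clauses W).2.2.2.2.2.2.2.1
    (trivial_characters_clauses W).2.2.2.2.2.2.2.2

end Witness

end Summit.Ventures.HodgeRepro.Tier4.Line1

end
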